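import Literature.RepresentationTheory.KonnoKonno2007.JunctionVacuumSection
import Literature.RepresentationTheory.KonnoKonno2007.JunctionSwapBargmann
import HarnessLib

/-!
# The hyperbolic vacuum pin: on the boosts, the canonical section and every Weil datum ARE `hypOp`

Literature reproduction (kernel, `[folklore]`; conventions of Folland 1989 §1.7, (4.24), §4.2 Prop. (4.39)).
Continuation of `JunctionVacuumSection` (the canonical vacuum-normalised implementer section `vacSection γ𝕎 g` of
the real unitary dual pair `U(P,Q) × U(R,S)`), of `JunctionHyperbolicDerivative` / `JunctionHyperbolicFockMatrix`
(the generator and the Fock matrix of the explicit hyperbolic implementer family `hypOp R S p₀ q₀ t`) and of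
`JunctionSwapBargmann` (the `W`-side family `hypOpW P Q r₀ s₀ t = swapS ∘ hypOp ∘ swapS⁻¹`).

## §1 Vacuum coefficients of Levi operators are POSITIVE REALS

`⟪k₀, g⟫ = ∫ h₀ g` is a positive real for a pointwise-positive Schwartz function `g`
(`exists_inner_vacL2_toL2_eq_of_pos`, the `=`-form of `inner_vacL2_toL2_ne_zero_of_pos`); hence
`vacCoeffS (leviS a) = ‖vacCoeffS (leviS a)‖` and the same for `hypLevi`, `hypOp`.

## §2 The canonical section on the boosts is `hypOp` on the nose

`vacSection γ𝕎 ((hypV p₀ q₀ t, 1)) = hypOp R S p₀ q₀ t` (`vacSection_junction_hypV_eq_hypOp`; the unimodular phase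
`‖c_t‖/c_t` of `vacSection_junction_hypV` is `1`), so every statement of `JunctionHyperbolicDerivative` /
`JunctionHyperbolicFockMatrix` holds for the section BY NAME: the slope `t⁻¹ (N(a_t) f − f) → hypOpGen f` on all of
`𝓢`, smoothness of every real functional along `t ↦ N(a_t) f`, and the explicit Fock slope
`t⁻¹ (N(a_t) B⁻¹F − B⁻¹F) → B⁻¹ (i (Σ_S (π z z' + π⁻¹ ∂∂') − Σ_R (…)) F)`.

## §3 Every genuine Weil datum agrees with `hypOp` on the boosts

For a REPRESENTATION `ω` of `G_∞ = U(P,Q) × U(R,S)` on `𝓢` which is an archimedean Weil datum over `ι𝕎`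
((w1) continuity of orbits, (w2) Heisenberg covariance, (w2′) unitary lifts):
`ω ((hypV p₀ q₀ t, 1)) = hypOp R S p₀ q₀ t` (`weilDatum_apply_hypV_eq_hypOp`).  Proof: by Schur the two differ
by a unimodular scalar `d t`; `d` is continuous ((w1)), multiplicative (`ω` and `hypOp` are one-parameter groups) and
EVEN — the sign flip `w = κ (weylKV p₀, 1) ∈ K` conjugates `a_t` to `a_{−t}`, and `μ₀(w) ∘ hypOp t ∘ μ₀(w)⁻¹ = hypOp (−t)`
exactly because both are implementers of the same map with positive-real vacuum coefficient (§1); so `d t = d (−t) =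
(d t)⁻¹`, `d² = 1`, and `d ≡ 1` since `ℝ` is connected.  Consequently the A-side clauses of any consumer stated for an
abstract datum `ω` (slopes, smoothness, Fock matrix on the boosts) are those of `hypOp`.

## §4 The `W`-side twin

Transport of implementers and of vacuum coefficients along the swap `swapS` (`isImplementerS_swap_conj`,
`vacCoeffS_swap_conj`: the swap is unitary on `L²` and fixes the Gaussian), whence `hypOpW` implements the boost
`(1, hypV r₀ s₀ t)` of the SECOND factor with positive-real vacuum coefficient and
`vacSection γ𝕎 ((1, hypV r₀ s₀ t)) = hypOpW P Q r₀ s₀ t` (`vacSection_junction_one_hypV_eq_hypOpW`); for a genuine Weil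
datum `ω ((1, hypV r₀ s₀ t)) = hypOpW P Q r₀ s₀ t` (`weilDatum_apply_one_hypV_eq_hypOpW`, the `V`-side pin of the
swapped datum `isArchWeilDatum_swap` read back through `swapS`).  The `W`-side slopes / smoothness / Fock slope
(planes `(p, r₀) | (p, s₀)`, `λ = −π⁻¹`; `(q, r₀) | (q, s₀)`, `λ = +π⁻¹`) follow BY NAME from `JunctionSwapBargmann`.

No records, no axioms beyond the standard trio; nothing of print is asserted (the Folland loci are conventions only).
-/

open MeasureTheory Complex Filter Topology
open scoped InnerProductSpace ComplexConjugate Real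

noncomputable section

namespace Literature.RepresentationTheory.KonnoKonno2007

open Literature.Analysis.SegalBargmann Literature.RepresentationTheory.HeisenbergGroup
open Literature.NumberTheory.Weil1964 Literature.Analysis.Distribution

/-! ## §1 Positivity of the Gaussian integrals -/

section Gaussian

variable {σ : Type*} [Fintype σ] [DecidableEq σ]

local notation "L2R" σ => Lp ℂ 2 (volume : Measure (σ → ℝ))
local notation "SR" σ => SchwartzMap (σ → ℝ) ℂ

/-- **A Gaussian integral is a positive real**: if a Schwartz function `g` takes positive real values everywhere then
`⟪k₀, g⟫_{L²} = ∫ h₀ g` is a positive real number. [cite: Folland1989, §1.7 (1.72)] -/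
theorem exists_inner_vacL2_toL2_eq_of_pos {g : SR σ} (hg : ∀ x, ∃ r : ℝ, 0 < r ∧ g x = r) :
    ∃ r : ℝ, 0 < r ∧ ⟪(vacL2 : L2R σ), toL2 g⟫_ℂ = r := by
  classical
  rw [← toL2_hermitePi_zero, toL2_hermitePi, inner_hermiteL2_left]
  set F : (σ → ℝ) → ℝ := fun x => ‖g x‖ * ‖hermitePi (0 : σ →₀ ℕ) x‖ with hF
  have hae : (fun x => (toL2 g : (σ → ℝ) → ℂ) x * conj (hermiteFun (herm (0 : σ →₀ ℕ)) x)) =ᵐ[volume]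
      fun x => ((F x : ℝ) : ℂ) := by
    filter_upwards [coeFn_toL2 g] with x hx
    obtain ⟨r, hr, hgr⟩ := hg x
    rw [hx, hF]
    simp only [hermitePi_apply]
    rw [hgr, hermiteFun_herm_zero_eq, Complex.conj_ofReal, Complex.norm_real, Complex.norm_real,
      Real.norm_of_nonneg hr.le, Real.norm_of_nonneg (vacProfile_pos x).le]
    push_cast
    ring
  have hFpos : ∀ x, 0 < F x := fun x => by
    obtain ⟨r, hr, hgr⟩ := hg x
    rw [hF]
    simp only [hermitePi_apply]
    rw [hgr, hermiteFun_herm_zero_eq, Complex.norm_real, Complex.norm_real, Real.norm_of_nonneg hr.le,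
      Real.norm_of_nonneg (vacProfile_pos x).le]
    exact mul_pos hr (vacProfile_pos x)
  have hFint : Integrable F volume := by
    refine ((SchwartzMap.integrable g).norm.mul_bdd (c := SchwartzMap.seminorm ℂ 0 0 (hermitePi (0 : σ →₀ ℕ)))
      (hermitePi (0 : σ →₀ ℕ)).continuous.norm.aestronglyMeasurable (Filter.Eventually.of_forall fun x => ?_))
    rw [norm_norm]
    exact SchwartzMap.norm_le_seminorm ℂ _ _
  refine ⟨∫ x, F x, ?_, ?_⟩
  · refine (integral_pos_iff_support_of_nonneg (fun x => (hFpos x).le) hFint).2 ?_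
    have hsupp : Function.support F = Set.univ := Set.eq_univ_of_forall fun x => (hFpos x).ne'
    rw [hsupp]
    exact isOpen_univ.measure_pos volume Set.univ_nonempty
  · rw [integral_congr_ae hae, integral_complex_ofReal]

omit [Fintype σ] [DecidableEq σ] in
/-- a positive real, read in `ℂ`, equals (the cast of) its norm. [folklore] -/
theorem ofReal_eq_norm_of_pos {r : ℝ} (hr : 0 < r) : ((r : ℝ) : ℂ) = ((‖((r : ℝ) : ℂ)‖ : ℝ) : ℂ) := by
  rw [Complex.norm_real, Real.norm_of_nonneg hr.le]

/-- `⟪k₀, g⟫ = ‖⟪k₀, g⟫‖` for a pointwise-positive `g`. [cite: Folland1989, §1.7 (1.72)] -/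
theorem inner_vacL2_toL2_eq_norm_of_pos {g : SR σ} (hg : ∀ x, ∃ r : ℝ, 0 < r ∧ g x = r) :
    ⟪(vacL2 : L2R σ), toL2 g⟫_ℂ = ((‖⟪(vacL2 : L2R σ), toL2 g⟫_ℂ‖ : ℝ) : ℂ) := by
  obtain ⟨r, hr, h⟩ := exists_inner_vacL2_toL2_eq_of_pos hg
  rw [h]
  exact ofReal_eq_norm_of_pos hr

/-- the Levi operator applied to the vacuum is a positive Gaussian: `(leviS a h₀)(x) = |det a|^{-1/2} h₀(a⁻¹ x) > 0`.
[cite: Folland1989, (4.24); §1.7 (1.72)] -/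
theorem leviS_hermitePi_zero_pos (a : (σ → ℝ) ≃ₗ[ℝ] (σ → ℝ)) (x : σ → ℝ) :
    ∃ r : ℝ, 0 < r ∧ leviS a (hermitePi 0) x = r := by
  refine ⟨_, mul_pos (Real.rpow_pos_of_pos (abs_pos.2 (LinearEquiv.isUnit_det' a).ne_zero) (-(1 / 2 : ℝ)))
    (vacProfile_pos (a.symm x)), ?_⟩
  rw [leviS_apply, hermitePi_apply, hermiteFun_herm_zero_eq, leviFactor]
  push_cast
  ring

/-- **Vacuum coefficients of Levi operators are positive reals**: `⟪k₀, leviS a h₀⟫ = ‖⟪k₀, leviS a h₀⟫‖`.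
[cite: Folland1989, (4.24); §1.7 (1.72)] -/
theorem vacCoeffS_leviS_eq_norm (a : (σ → ℝ) ≃ₗ[ℝ] (σ → ℝ)) :
    vacCoeffS (leviS a) = ((‖vacCoeffS (leviS a)‖ : ℝ) : ℂ) :=
  inner_vacL2_toL2_eq_norm_of_pos (leviS_hermitePi_zero_pos a)

/-- … as an existence statement: `vacCoeffS (leviS a) = r` for some real `r > 0`. [cite: Folland1989, (4.24)] -/
theorem exists_vacCoeffS_leviS_eq (a : (σ → ℝ) ≃ₗ[ℝ] (σ → ℝ)) :
    ∃ r : ℝ, 0 < r ∧ vacCoeffS (leviS a) = r :=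
  exists_inner_vacL2_toL2_eq_of_pos (leviS_hermitePi_zero_pos a)

/-- hence the vacuum normalisation of a Levi operator is the operator itself. [cite: Folland1989, Prop. (4.39)] -/
theorem vnormS_leviS (a : (σ → ℝ) ≃ₗ[ℝ] (σ → ℝ)) : vnormS (leviS a) = leviS a :=
  vnormS_eq_self (vacCoeffS_leviS_eq_norm a) (vacCoeffS_leviS_ne_zero a)

end Gaussian

/-! ## §2 The canonical section on the boosts -/

namespace RealDualPair

open Literature.NumberTheory.Automorphic Literature.NumberTheory.Automorphic.UnitaryGroup

variable {P Q : Type*} (R S : Type*) [Fintype P] [DecidableEq P] [Fintype Q] [DecidableEq Q] [Fintype R]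
  [DecidableEq R] [Fintype S] [DecidableEq S] (p₀ : P) (q₀ : Q)

local notation "L2R" σ => Lp ℂ 2 (volume : Measure (σ → ℝ))
local notation "SR" σ => SchwartzMap (σ → ℝ) ℂ
local notation "PV" σ => (σ → ℝ) × (σ → ℝ)

-- the symplectic action of `G_∞` on phase space through `ι𝕎`, as a family of maps (as in `JunctionVacuumSection`).
set_option quotPrecheck false in
local notation "γ𝕎[" P ", " Q ", " R ", " S "]" =>
  fun g : Ginf P Q R S => (⇑((ι𝕎 P Q R S g).1 : (PV (DPIdx P Q R S)) ≃ₗ[ℝ] PV (DPIdx P Q R S)) :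
    PhaseMap (DPIdx P Q R S))

/-- `vacCoeffS (hypLevi t) = ‖vacCoeffS (hypLevi t)‖`: the Levi family has positive-real vacuum coefficients.
[cite: Folland1989, (4.24)] -/
theorem vacCoeffS_hypLevi_eq_norm (t : ℝ) :
    vacCoeffS (hypLevi R S p₀ q₀ t) = ((‖vacCoeffS (hypLevi R S p₀ q₀ t)‖ : ℝ) : ℂ) := by
  unfold hypLevi
  exact vacCoeffS_leviS_eq_norm _

/-- `vacCoeffS (hypOp t) = ‖vacCoeffS (hypOp t)‖`: the hyperbolic implementer family has positive-real vacuum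
coefficients. [cite: Folland1989, (4.24), Prop. (4.39)] -/
theorem vacCoeffS_hypOp_eq_norm (t : ℝ) :
    vacCoeffS (hypOp R S p₀ q₀ t) = ((‖vacCoeffS (hypOp R S p₀ q₀ t)‖ : ℝ) : ℂ) := by
  rw [vacCoeffS_hypOp]
  exact vacCoeffS_hypLevi_eq_norm R S p₀ q₀ t

/-- the vacuum normalisation of `hypOp t` is `hypOp t`. [cite: Folland1989, Prop. (4.39)] -/
theorem vnormS_hypOp (t : ℝ) : vnormS (hypOp R S p₀ q₀ t) = hypOp R S p₀ q₀ t :=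
  vnormS_eq_self (vacCoeffS_hypOp_eq_norm R S p₀ q₀ t) (vacCoeffS_hypOp_ne_zero R S p₀ q₀ t)

/-- **The canonical section on the boosts IS `hypOp`**: `vacSection γ𝕎 ((hypV p₀ q₀ t, 1)) = hypOp R S p₀ q₀ t` — for
ANY plane `{e_{p₀}, e_{q₀}}`, no rank hypothesis. [cite: Folland1989, (4.24), Prop. (4.39)] -/
theorem vacSection_junction_hypV_eq_hypOp (t : ℝ) :
    vacSection (γ𝕎[P, Q, R, S]) (((hypV p₀ q₀ t : UForm P Q), (1 : UForm R S)) : Ginf P Q R S) =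
      hypOp R S p₀ q₀ t :=
  (eq_vacSection (γ := γ𝕎[P, Q, R, S])
    (g := (((hypV p₀ q₀ t : UForm P Q), (1 : UForm R S)) : Ginf P Q R S))
    (isImplementerS_hypOp R S p₀ q₀ t) (vacCoeffS_hypOp_eq_norm R S p₀ q₀ t) (vacCoeffS_hypOp_ne_zero R S p₀ q₀ t)).symm

/-- applied form. [cite: Folland1989, Prop. (4.39)] -/
theorem vacSection_junction_hypV_apply (t : ℝ) (f : SR (DPIdx P Q R S)) :
    vacSection (γ𝕎[P, Q, R, S]) (((hypV p₀ q₀ t : UForm P Q), (1 : UForm R S)) : Ginf P Q R S) f =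
      hypOp R S p₀ q₀ t f := by
  rw [vacSection_junction_hypV_eq_hypOp]

/-- **the slope of the section on all of `𝓢`**: `t⁻¹ (N(a_t) f − f) → hypOpGen f` as `t → 0`, `t ≠ 0`.
[cite: Folland1989, (4.24), Prop. (4.39)] -/
theorem tendsto_vacSection_hypV_sub_div (f : SR (DPIdx P Q R S)) :
    Tendsto (fun t : ℝ => t⁻¹ •
      (vacSection (γ𝕎[P, Q, R, S]) (((hypV p₀ q₀ t : UForm P Q), (1 : UForm R S)) : Ginf P Q R S) f - f))
      (𝓝[≠] 0) (𝓝 (hypOpGen R S p₀ q₀ f)) := by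
  simp only [vacSection_junction_hypV_apply]
  exact tendsto_hypOp_sub_div R S p₀ q₀ f

/-- the same slope with the complex scalar `(t : ℂ)⁻¹`. [cite: Folland1989, (4.24), Prop. (4.39)] -/
theorem tendsto_vacSection_hypV_sub_div_ofReal (f : SR (DPIdx P Q R S)) :
    Tendsto (fun t : ℝ => ((t : ℝ) : ℂ)⁻¹ •
      (vacSection (γ𝕎[P, Q, R, S]) (((hypV p₀ q₀ t : UForm P Q), (1 : UForm R S)) : Ginf P Q R S) f - f))
      (𝓝[≠] 0) (𝓝 (hypOpGen R S p₀ q₀ f)) := by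
  simp only [vacSection_junction_hypV_apply]
  exact tendsto_hypOp_sub_div_ofReal R S p₀ q₀ f

/-- **every real functional is smooth along the section on the boosts**, with derivative through `hypOpGen`.
[cite: Folland1989, (4.24), Prop. (4.39)] -/
theorem hasDerivAt_apply_vacSection_hypV {G : Type*} [NormedAddCommGroup G] [NormedSpace ℝ G]
    (T : (SR (DPIdx P Q R S)) →L[ℝ] G) (f : SR (DPIdx P Q R S)) (s₀ : ℝ) :
    HasDerivAt (fun s : ℝ =>
        T (vacSection (γ𝕎[P, Q, R, S]) (((hypV p₀ q₀ s : UForm P Q), (1 : UForm R S)) : Ginf P Q R S) f))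
      (T (hypOpGen R S p₀ q₀ (hypOp R S p₀ q₀ s₀ f))) s₀ := by
  simp only [vacSection_junction_hypV_apply]
  exact hasDerivAt_apply_hypOp R S p₀ q₀ T f s₀

/-- `C^∞` version. [cite: Folland1989, (4.24), Prop. (4.39)] -/
theorem contDiff_apply_vacSection_hypV {G : Type*} [NormedAddCommGroup G] [NormedSpace ℝ G]
    (T : (SR (DPIdx P Q R S)) →L[ℝ] G) (f : SR (DPIdx P Q R S)) :
    ContDiff ℝ ((⊤ : ℕ∞) : WithTop ℕ∞) fun s : ℝ =>
      T (vacSection (γ𝕎[P, Q, R, S]) (((hypV p₀ q₀ s : UForm P Q), (1 : UForm R S)) : Ginf P Q R S) f) := by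
  simp only [vacSection_junction_hypV_apply]
  exact contDiff_apply_hypOp R S p₀ q₀ T f

open MvPolynomial in
/-- **the Fock slope of the section on the boosts** (printed form `(i/λ) z z' + iλ ∂∂'`, `λ = ∓π⁻¹`):
`t⁻¹ (N(a_t) B⁻¹F − B⁻¹F) → B⁻¹ (i (Σ_{s} (π z_{(p₀,s)} z_{(q₀,s)} + π⁻¹ ∂∂) − Σ_{r} (π z_{(p₀,r)} z_{(q₀,r)} + π⁻¹ ∂∂)) F)`.
[cite: Folland1989, §1.7, (4.24), Prop. (4.39)] -/
theorem tendsto_vacSection_hypV_binvPi_sub_div_frame (F : MvPolynomial (DPIdx P Q R S) ℂ) :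
    Tendsto (fun t : ℝ => ((t : ℝ) : ℂ)⁻¹ •
      (vacSection (γ𝕎[P, Q, R, S]) (((hypV p₀ q₀ t : UForm P Q), (1 : UForm R S)) : Ginf P Q R S) (binvPi F) -
        binvPi F)) (𝓝[≠] 0)
      (𝓝 (binvPi (I • ((∑ s : S, hypPairSymb (Sum.inr (Sum.inl (p₀, s))) (Sum.inl (Sum.inr (q₀, s))) F) -
        ∑ r : R, hypPairSymb (Sum.inl (Sum.inl (p₀, r))) (Sum.inr (Sum.inr (q₀, r))) F)))) := by
  simp only [vacSection_junction_hypV_apply]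
  exact tendsto_hypOp_binvPi_sub_div_frame R S p₀ q₀ F

/-! ## §3 Every genuine archimedean Weil datum agrees with `hypOp` on the boosts -/

section WeilDatum

/-- Notation (NOT a definition): `HasUnitaryLift[σ] A` abbreviates the (w2′) clause shape of
`IsArchWeilDatum.exists_lift`. -/
local notation "HasUnitaryLift[" σ "]" A:max =>
  ∃ U : Lp ℂ 2 (volume : Measure (σ → ℝ)) ≃ₗᵢ[ℂ] Lp ℂ 2 (volume : Measure (σ → ℝ)),
    LiftsTo A ((LinearIsometryEquiv.toContinuousLinearEquiv U :
        Lp ℂ 2 (volume : Measure (σ → ℝ)) ≃L[ℂ] Lp ℂ 2 (volume : Measure (σ → ℝ))) :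
      Lp ℂ 2 (volume : Measure (σ → ℝ)) →L[ℂ] Lp ℂ 2 (volume : Measure (σ → ℝ)))

/-- **The sign flip intertwines `hypOp t` with `hypOp (−t)`**: for `u = dualPairι (weylKV p₀, 1)` (the matrix
`diag(−1 at e_{p₀})` of the maximal compact), `μ₀(u) ∘ hypOp t = hypOp (−t) ∘ μ₀(u)` — both sides implement
`ι𝕎 (a_{−t} · w)` and have positive-real vacuum coefficient, so both are the canonical section there.
[cite: Folland1989, (4.24), §4.2 Prop. (4.39)] -/
theorem unitaryOpPi_weyl_comp_hypOp (t : ℝ) :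
    (unitaryOpPi (dualPairι ((weylKV p₀, 1) : DPK P Q R S))).comp (hypOp R S p₀ q₀ t) =
      (hypOp R S p₀ q₀ (-t)).comp (unitaryOpPi (dualPairι ((weylKV p₀, 1) : DPK P Q R S))) := by
  set u : Matrix.unitaryGroup (DPIdx P Q R S) ℂ := dualPairι ((weylKV p₀, 1) : DPK P Q R S) with hu
  set w : Ginf P Q R S := κ P Q R S ((weylKV p₀, 1) : DPK P Q R S) with hw_def
  set a : ℝ → Ginf P Q R S := fun s => (((hypV p₀ q₀ s : UForm P Q), (1 : UForm R S)) : Ginf P Q R S)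
    with ha_def
  -- the group identity `w · a_t = a_{−t} · w`
  have hw : w * a t = a (-t) * w := by
    have h1 : w * a t * w⁻¹ = a (-t) := by
      rw [hw_def, ha_def]
      refine Prod.ext ?_ ?_
      · simp only [κ, MonoidHom.prodMap, MonoidHom.prod_apply, MonoidHom.coe_comp, Function.comp_apply,
          MonoidHom.coe_fst, MonoidHom.coe_snd, Prod.fst_mul, Prod.fst_inv]
        exact kV_weylKV_mul_hypV_mul_inv p₀ q₀ t
      · simp only [κ, MonoidHom.prodMap, MonoidHom.prod_apply, MonoidHom.coe_comp, Function.comp_apply,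
          MonoidHom.coe_fst, MonoidHom.coe_snd, Prod.snd_mul, Prod.snd_inv, map_one, mul_one, inv_one]
    rw [← h1, inv_mul_cancel_right]
  -- the phase maps of both composites are `ι𝕎 (a_{−t} · w)`
  have hγw : (⇑((ι𝕎 P Q R S w).1 : (PV (DPIdx P Q R S)) ≃ₗ[ℝ] PV (DPIdx P Q R S)) : PhaseMap (DPIdx P Q R S)) =
      realify u := funext fun pq => by rw [hw_def, ι𝕎_κ_apply]
  have hφ₂ : (γ𝕎[P, Q, R, S]) (a (-t) * w) = (γ𝕎[P, Q, R, S]) (a (-t)) ∘ realify u := by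
    funext pq
    simp only [Function.comp_apply]
    rw [symplecticPhaseMap_mul, ← hγw]
  have hφ₁ : (γ𝕎[P, Q, R, S]) (a (-t) * w) = realify u ∘ (γ𝕎[P, Q, R, S]) (a t) := by
    funext pq
    simp only [Function.comp_apply]
    rw [← hw, symplecticPhaseMap_mul, ← hγw]
  have hX₁ : IsImplementerS ((γ𝕎[P, Q, R, S]) (a (-t) * w)) ((unitaryOpPi u).comp (hypOp R S p₀ q₀ t)) := by
    rw [hφ₁]
    exact (isImplementerS_unitaryOpPi_realify u).comp (isImplementerS_hypOp R S p₀ q₀ t)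
  have hX₂ : IsImplementerS ((γ𝕎[P, Q, R, S]) (a (-t) * w)) ((hypOp R S p₀ q₀ (-t)).comp (unitaryOpPi u)) := by
    rw [hφ₂]
    exact (isImplementerS_hypOp R S p₀ q₀ (-t)).comp (isImplementerS_unitaryOpPi_realify u)
  -- vacuum coefficients: conjugating / composing with `μ₀` changes nothing
  have hv₁ : vacCoeffS ((unitaryOpPi u).comp (hypOp R S p₀ q₀ t)) = vacCoeffS (hypOp R S p₀ q₀ t) := by
    have h := vacCoeffS_unitaryOpPi_comp_comp u 1 (hypOp R S p₀ q₀ t)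
    rwa [unitaryOpPi_one, ContinuousLinearMap.comp_id] at h
  have hv₂ : vacCoeffS ((hypOp R S p₀ q₀ (-t)).comp (unitaryOpPi u)) = vacCoeffS (hypOp R S p₀ q₀ (-t)) := by
    have h := vacCoeffS_unitaryOpPi_comp_comp 1 u (hypOp R S p₀ q₀ (-t))
    rwa [unitaryOpPi_one, ContinuousLinearMap.id_comp] at h
  rw [eq_vacSection hX₁ (by rw [hv₁]; exact vacCoeffS_hypOp_eq_norm R S p₀ q₀ t)
      (by rw [hv₁]; exact vacCoeffS_hypOp_ne_zero R S p₀ q₀ t),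
    eq_vacSection hX₂ (by rw [hv₂]; exact vacCoeffS_hypOp_eq_norm R S p₀ q₀ (-t))
      (by rw [hv₂]; exact vacCoeffS_hypOp_ne_zero R S p₀ q₀ (-t))]

/-- applied form of `unitaryOpPi_weyl_comp_hypOp`. [cite: Folland1989, Prop. (4.39)] -/
theorem unitaryOpPi_weyl_hypOp_apply (t : ℝ) (f : SR (DPIdx P Q R S)) :
    unitaryOpPi (dualPairι ((weylKV p₀, 1) : DPK P Q R S)) (hypOp R S p₀ q₀ t f) =
      hypOp R S p₀ q₀ (-t) (unitaryOpPi (dualPairι ((weylKV p₀, 1) : DPK P Q R S)) f) := by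
  have h := congrArg (fun T : (SR (DPIdx P Q R S)) →L[ℂ] SR (DPIdx P Q R S) => T f)
    (unitaryOpPi_weyl_comp_hypOp R S p₀ q₀ t)
  simpa only [ContinuousLinearMap.comp_apply] using h

variable {R S p₀ q₀}

/-- **Schur on the boosts**: a genuine representation `ω` that is an archimedean Weil datum over `ι𝕎` acts on the
boost `a_t = (hypV p₀ q₀ t, 1)` by a unimodular multiple `d t` of `hypOp t`, where `d` is CONTINUOUS, `d 0 = 1`,
MULTIPLICATIVE and EVEN. [cite: Folland1989, §4.2, the Schur remark p. 156; Prop. (4.39)] -/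
theorem weilDatum_exists_boostScalar {ω : Representation ℂ (Ginf P Q R S) (SR (DPIdx P Q R S))}
    (hW : IsArchWeilDatum (ι𝕎 P Q R S) ω) (p₀ : P) (q₀ : Q) :
    ∃ d : ℝ → ℂ, Continuous d ∧ d 0 = 1 ∧ (∀ s t, d (s + t) = d s * d t) ∧ (∀ t, d (-t) = d t) ∧
      ∀ t f, ω (((hypV p₀ q₀ t : UForm P Q), (1 : UForm R S)) : Ginf P Q R S) f = d t • hypOp R S p₀ q₀ t f := by
  set a : ℝ → Ginf P Q R S := fun s => (((hypV p₀ q₀ s : UForm P Q), (1 : UForm R S)) : Ginf P Q R S)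
    with ha_def
  have ha : ∀ s t, a (s + t) = a s * a t := fun s t => by
    rw [ha_def]
    exact Prod.ext (hypV_add p₀ q₀ s t) (mul_one _).symm
  have ha0 : a 0 = 1 := Prod.ext (hypV_zero p₀ q₀) rfl
  have h0 : (hermitePi (0 : DPIdx P Q R S →₀ ℕ) : SR (DPIdx P Q R S)) ≠ 0 := hermitePi_zero_ne_zero
  -- Schur along the boosts
  have hB : IsPhaseCovariantS (fun t => (γ𝕎[P, Q, R, S]) (a t)) (fun t => ω (a t)) :=
    fun t p q f => hW.covariant (a t) p q f
  have hV : IsPhaseCovariantS (fun t => (γ𝕎[P, Q, R, S]) (a t))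
      (fun t => (hypOp R S p₀ q₀ t : (SR (DPIdx P Q R S)) →ₗ[ℂ] SR (DPIdx P Q R S))) :=
    isPhaseCovariantS_hypOp_hypV (R := R) (S := S) p₀ q₀
  have hBl : ∀ t, HasUnitaryLift[DPIdx P Q R S] (ω (a t)) := fun t => hW.exists_lift (a t)
  have hVl : ∀ t, HasUnitaryLift[DPIdx P Q R S]
      (hypOp R S p₀ q₀ t : (SR (DPIdx P Q R S)) →ₗ[ℂ] SR (DPIdx P Q R S)) :=
    fun t => exists_liftsTo_hypOp R S p₀ q₀ t
  obtain ⟨UB, hUB⟩ := exists_liftFamily hBl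
  obtain ⟨UV, hUV⟩ := exists_liftFamily hVl
  set d : ℝ → ℂ := relCoeff UV UB with hd_def
  have hd : ∀ t f, ω (a t) f = d t • hypOp R S p₀ q₀ t f := fun t f => by
    have h1 := eq_relCoeff_smul_of_liftsTo hV hB hUV hUB t f
    simpa only [ContinuousLinearMap.coe_coe] using h1
  -- continuity ((w1) for `ω`, joint continuity of `hypOp`)
  have hdc : Continuous d := by
    refine continuous_relCoeff (continuous_lift_vacL2 hUV ?_) (continuous_lift_vacL2 hUB ?_)
    · exact continuous_hypOp_apply R S p₀ q₀ _
    · have hac : Continuous a := (continuous_hypV p₀ q₀).prodMk continuous_const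
      exact (hW.continuous_apply _).comp hac
  -- nonvanishing of the reference vectors `hypOp t h₀`
  have hne : ∀ t, hypOp R S p₀ q₀ t (hermitePi 0) ≠ 0 := fun t => (isImplementerS_hypOp R S p₀ q₀ t).apply_ne_zero h0
  -- `d 0 = 1`
  have hd0 : d 0 = 1 := by
    have h := hd 0 (hermitePi 0)
    rw [ha0, map_one, Module.End.one_apply] at h
    have h' : (1 : ℂ) • hypOp R S p₀ q₀ 0 (hermitePi 0) = d 0 • hypOp R S p₀ q₀ 0 (hermitePi 0) := by
      rw [one_smul, ← h, hypOp_zero, ContinuousLinearMap.id_apply]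
    exact ((smul_left_injective ℂ (hne 0)) h').symm
  -- multiplicativity (`ω` is a homomorphism, `hypOp` a one-parameter group)
  have hmul : ∀ s t, d (s + t) = d s * d t := fun s t => by
    have h := hd (s + t) (hermitePi 0)
    rw [ha, map_mul, Module.End.mul_apply, hd t, map_smul, hd s, smul_smul, hypOp_add_apply, mul_comm] at h
    exact (smul_left_injective ℂ (by rw [← hypOp_add_apply]; exact hne (s + t)) h).symm
  -- evenness (the Weyl element)
  have heven : ∀ t, d (-t) = d t := by
    intro t
    set k₀ : DPK P Q R S := (weylKV p₀, 1) with hk₀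
    set u : Matrix.unitaryGroup (DPIdx P Q R S) ℂ := dualPairι k₀ with hu
    set w : Ginf P Q R S := κ P Q R S k₀ with hw_def
    have hw : w * a t = a (-t) * w := by
      have h1 : w * a t * w⁻¹ = a (-t) := by
        rw [hw_def, ha_def, hk₀]
        refine Prod.ext ?_ ?_
        · simp only [κ, MonoidHom.prodMap, MonoidHom.prod_apply, MonoidHom.coe_comp, Function.comp_apply,
            MonoidHom.coe_fst, MonoidHom.coe_snd, Prod.fst_mul, Prod.fst_inv]
          exact kV_weylKV_mul_hypV_mul_inv p₀ q₀ t
        · simp only [κ, MonoidHom.prodMap, MonoidHom.prod_apply, MonoidHom.coe_comp, Function.comp_apply,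
            MonoidHom.coe_fst, MonoidHom.coe_snd, Prod.snd_mul, Prod.snd_inv, map_one, mul_one, inv_one]
      rw [← h1, inv_mul_cancel_right]
    -- Schur on the maximal compact: `ω (κ k) = c k • μ₀(dualPairι k)`
    have hK : IsPhaseCovariantS (fun k => (γ𝕎[P, Q, R, S]) (κ P Q R S k)) (fun k => ω (κ P Q R S k)) :=
      fun k p q f => hW.covariant (κ P Q R S k) p q f
    have hμ : IsPhaseCovariantS (fun k => (γ𝕎[P, Q, R, S]) (κ P Q R S k))
        (fun k => ((unitaryOpPi (dualPairι k) : (SR (DPIdx P Q R S)) →L[ℂ] SR (DPIdx P Q R S)) :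
          (SR (DPIdx P Q R S)) →ₗ[ℂ] SR (DPIdx P Q R S))) := fun k p q f => by
      have h := (isImplementerS_unitaryOpPi_realify (dualPairι k)).1 p q f
      simp only [ContinuousLinearMap.coe_coe]
      rw [ι𝕎_κ_apply]
      exact h
    have hKl : ∀ k, HasUnitaryLift[DPIdx P Q R S] (ω (κ P Q R S k)) := fun k => hW.exists_lift _
    have hμl : ∀ k, HasUnitaryLift[DPIdx P Q R S]
        ((unitaryOpPi (dualPairι k) : (SR (DPIdx P Q R S)) →L[ℂ] SR (DPIdx P Q R S)) :
          (SR (DPIdx P Q R S)) →ₗ[ℂ] SR (DPIdx P Q R S)) :=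
      fun k => (isImplementerS_unitaryOpPi_realify (dualPairι k)).2
    obtain ⟨UK, hUK⟩ := exists_liftFamily hKl
    obtain ⟨Uμ, hUμ⟩ := exists_liftFamily hμl
    have hc : ∀ f, ω w f = relCoeff Uμ UK k₀ • unitaryOpPi u f := fun f => by
      have h1 := eq_relCoeff_smul_of_liftsTo hμ hK hUμ hUK k₀ f
      simpa only [ContinuousLinearMap.coe_coe] using h1
    have hc0 : relCoeff Uμ UK k₀ ≠ 0 := fun h => by
      have h1 := norm_relCoeff_of_liftsTo hμ hK hUμ hUK k₀
      rw [h, norm_zero] at h1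
      exact zero_ne_one h1
    -- compare `ω (a_{−t} · w) h₀` computed in the two orders
    have key : ω (a (-t)) (ω w (hermitePi 0)) = ω w (ω (a t) (hermitePi 0)) := by
      rw [← Module.End.mul_apply, ← map_mul, ← hw, map_mul, Module.End.mul_apply]
    rw [hc, map_smul, hd (-t), hd t, map_smul, hc, smul_smul, smul_smul, unitaryOpPi_weyl_hypOp_apply] at key
    have hX : hypOp R S p₀ q₀ (-t) (unitaryOpPi u (hermitePi 0)) ≠ 0 := by
      rw [hu, unitaryOpPi_hermitePi_zero]
      exact hne (-t)
    have h2 := smul_left_injective ℂ hX key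
    -- `d(−t) · c = c · d t`
    have h3 : relCoeff Uμ UK k₀ * d (-t) = d t * relCoeff Uμ UK k₀ := h2
    rw [mul_comm (d t)] at h3
    exact mul_left_cancel₀ hc0 h3
  refine ⟨d, hdc, hd0, hmul, heven, fun t f => hd t f⟩

/-- **The hyperbolic vacuum pin for a genuine Weil datum**: every representation `ω` of `G_∞ = U(P,Q) × U(R,S)` on `𝓢`
that is an archimedean Weil datum over `ι𝕎` acts on the boosts by `hypOp`:
`ω ((hypV p₀ q₀ t, 1)) = hypOp R S p₀ q₀ t`.  (The Schur scalar `d` of `weilDatum_exists_boostScalar` satisfies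
`d t² = d t · d (−t) = d 0 = 1`, so `d` is a continuous `{±1}`-valued function on `ℝ` with `d 0 = 1`.)
[cite: Folland1989, §4.2, the Schur remark p. 156; (4.24); Prop. (4.39)] -/
theorem weilDatum_apply_hypV_eq_hypOp {ω : Representation ℂ (Ginf P Q R S) (SR (DPIdx P Q R S))}
    (hW : IsArchWeilDatum (ι𝕎 P Q R S) ω) (p₀ : P) (q₀ : Q) (t : ℝ) (f : SR (DPIdx P Q R S)) :
    ω (((hypV p₀ q₀ t : UForm P Q), (1 : UForm R S)) : Ginf P Q R S) f = hypOp R S p₀ q₀ t f := by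
  obtain ⟨d, hdc, hd0, hmul, heven, hd⟩ := weilDatum_exists_boostScalar (R := R) (S := S) hW p₀ q₀
  -- `d s ∈ {1, −1}` for every `s`
  have hsq : ∀ s, d s = 1 ∨ d s = -1 := fun s => by
    have h : d s ^ 2 = 1 := by rw [sq, ← hd0, ← add_neg_cancel s, hmul, heven]
    exact sq_eq_one_iff.1 h
  -- continuity forces `d ≡ 1`
  have hone : d t = 1 := by
    rcases hsq t with h | h
    · exact h
    · exfalso
      have hre : Continuous fun s => (d s).re := Complex.continuous_re.comp hdc
      have hmem : (0 : ℝ) ∈ Set.uIcc ((fun s => (d s).re) 0) ((fun s => (d s).re) t) := by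
        simp only [hd0, h, Complex.one_re, Complex.neg_re]
        exact Set.mem_uIcc.2 (Or.inr ⟨by norm_num, by norm_num⟩)
      obtain ⟨s, -, hs⟩ := intermediate_value_uIcc hre.continuousOn hmem
      rcases hsq s with h1 | h1
      · simp only [h1, Complex.one_re] at hs
        exact one_ne_zero hs
      · simp only [h1, Complex.neg_re, Complex.one_re] at hs
        norm_num at hs
  rw [hd, hone, one_smul]

/-- the pin as an identity of linear maps `𝓢 →ₗ 𝓢`. [cite: Folland1989, §4.2 p. 156, Prop. (4.39)] -/
theorem weilDatum_apply_hypV_eq {ω : Representation ℂ (Ginf P Q R S) (SR (DPIdx P Q R S))}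
    (hW : IsArchWeilDatum (ι𝕎 P Q R S) ω) (p₀ : P) (q₀ : Q) (t : ℝ) :
    ω (((hypV p₀ q₀ t : UForm P Q), (1 : UForm R S)) : Ginf P Q R S) =
      ((hypOp R S p₀ q₀ t : (SR (DPIdx P Q R S)) →L[ℂ] SR (DPIdx P Q R S)) :
        (SR (DPIdx P Q R S)) →ₗ[ℂ] SR (DPIdx P Q R S)) :=
  LinearMap.ext fun f => by rw [ContinuousLinearMap.coe_coe]; exact weilDatum_apply_hypV_eq_hypOp hW p₀ q₀ t f

/-- … and it coincides with the canonical section on the boosts. [cite: Folland1989, Prop. (4.39)] -/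
theorem weilDatum_apply_hypV_eq_vacSection {ω : Representation ℂ (Ginf P Q R S) (SR (DPIdx P Q R S))}
    (hW : IsArchWeilDatum (ι𝕎 P Q R S) ω) (p₀ : P) (q₀ : Q) (t : ℝ) (f : SR (DPIdx P Q R S)) :
    ω (((hypV p₀ q₀ t : UForm P Q), (1 : UForm R S)) : Ginf P Q R S) f =
      vacSection (γ𝕎[P, Q, R, S]) (((hypV p₀ q₀ t : UForm P Q), (1 : UForm R S)) : Ginf P Q R S) f := by
  rw [weilDatum_apply_hypV_eq_hypOp hW, vacSection_junction_hypV_apply]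

/-- **the slope of a Weil datum on the boosts, on all of `𝓢`**: `t⁻¹ (ω(a_t) f − f) → hypOpGen f`.
[cite: Folland1989, (4.24), Prop. (4.39)] -/
theorem weilDatum_tendsto_hypV_sub_div {ω : Representation ℂ (Ginf P Q R S) (SR (DPIdx P Q R S))}
    (hW : IsArchWeilDatum (ι𝕎 P Q R S) ω) (p₀ : P) (q₀ : Q) (f : SR (DPIdx P Q R S)) :
    Tendsto (fun t : ℝ => t⁻¹ •
      (ω (((hypV p₀ q₀ t : UForm P Q), (1 : UForm R S)) : Ginf P Q R S) f - f))
      (𝓝[≠] 0) (𝓝 (hypOpGen R S p₀ q₀ f)) := by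
  simp only [weilDatum_apply_hypV_eq_hypOp hW]
  exact tendsto_hypOp_sub_div R S p₀ q₀ f

/-- the same slope with the complex scalar `(t : ℂ)⁻¹`. [cite: Folland1989, (4.24), Prop. (4.39)] -/
theorem weilDatum_tendsto_hypV_sub_div_ofReal {ω : Representation ℂ (Ginf P Q R S) (SR (DPIdx P Q R S))}
    (hW : IsArchWeilDatum (ι𝕎 P Q R S) ω) (p₀ : P) (q₀ : Q) (f : SR (DPIdx P Q R S)) :
    Tendsto (fun t : ℝ => ((t : ℝ) : ℂ)⁻¹ •
      (ω (((hypV p₀ q₀ t : UForm P Q), (1 : UForm R S)) : Ginf P Q R S) f - f))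
      (𝓝[≠] 0) (𝓝 (hypOpGen R S p₀ q₀ f)) := by
  simp only [weilDatum_apply_hypV_eq_hypOp hW]
  exact tendsto_hypOp_sub_div_ofReal R S p₀ q₀ f

/-- **every real functional is smooth along a Weil datum on the boosts**, derivative through `hypOpGen`.
[cite: Folland1989, (4.24), Prop. (4.39)] -/
theorem weilDatum_hasDerivAt_apply_hypV {ω : Representation ℂ (Ginf P Q R S) (SR (DPIdx P Q R S))}
    (hW : IsArchWeilDatum (ι𝕎 P Q R S) ω) (p₀ : P) (q₀ : Q) {G : Type*} [NormedAddCommGroup G]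
    [NormedSpace ℝ G] (T : (SR (DPIdx P Q R S)) →L[ℝ] G) (f : SR (DPIdx P Q R S)) (s₀ : ℝ) :
    HasDerivAt (fun s : ℝ => T (ω (((hypV p₀ q₀ s : UForm P Q), (1 : UForm R S)) : Ginf P Q R S) f))
      (T (hypOpGen R S p₀ q₀ (hypOp R S p₀ q₀ s₀ f))) s₀ := by
  simp only [weilDatum_apply_hypV_eq_hypOp hW]
  exact hasDerivAt_apply_hypOp R S p₀ q₀ T f s₀

/-- `C^∞` version. [cite: Folland1989, (4.24), Prop. (4.39)] -/
theorem weilDatum_contDiff_apply_hypV {ω : Representation ℂ (Ginf P Q R S) (SR (DPIdx P Q R S))}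
    (hW : IsArchWeilDatum (ι𝕎 P Q R S) ω) (p₀ : P) (q₀ : Q) {G : Type*} [NormedAddCommGroup G]
    [NormedSpace ℝ G] (T : (SR (DPIdx P Q R S)) →L[ℝ] G) (f : SR (DPIdx P Q R S)) :
    ContDiff ℝ ((⊤ : ℕ∞) : WithTop ℕ∞) fun s : ℝ => T (ω (((hypV p₀ q₀ s : UForm P Q), (1 : UForm R S)) : Ginf P Q R S) f) := by
  simp only [weilDatum_apply_hypV_eq_hypOp hW]
  exact contDiff_apply_hypOp R S p₀ q₀ T f

open MvPolynomial in
/-- **the Fock slope of a Weil datum on the boosts** (printed form `(i/λ) z z' + iλ ∂∂'`, `λ = ∓π⁻¹`).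
[cite: Folland1989, §1.7, (4.24), Prop. (4.39)] -/
theorem weilDatum_tendsto_hypV_binvPi_sub_div_frame
    {ω : Representation ℂ (Ginf P Q R S) (SR (DPIdx P Q R S))} (hW : IsArchWeilDatum (ι𝕎 P Q R S) ω)
    (p₀ : P) (q₀ : Q) (F : MvPolynomial (DPIdx P Q R S) ℂ) :
    Tendsto (fun t : ℝ => ((t : ℝ) : ℂ)⁻¹ •
      (ω (((hypV p₀ q₀ t : UForm P Q), (1 : UForm R S)) : Ginf P Q R S) (binvPi F) - binvPi F)) (𝓝[≠] 0)
      (𝓝 (binvPi (I • ((∑ s : S, hypPairSymb (Sum.inr (Sum.inl (p₀, s))) (Sum.inl (Sum.inr (q₀, s))) F) -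
        ∑ r : R, hypPairSymb (Sum.inl (Sum.inl (p₀, r))) (Sum.inr (Sum.inr (q₀, r))) F)))) := by
  simp only [weilDatum_apply_hypV_eq_hypOp hW]
  exact tendsto_hypOp_binvPi_sub_div_frame R S p₀ q₀ F

end WeilDatum

/-! ## §4 The `W`-side twin: the canonical section on the boosts of the second factor is `hypOpW` -/

section WSide

/-- Notation (NOT a definition): `HasUnitaryLift[σ] A` abbreviates the (w2′) clause shape of
`IsArchWeilDatum.exists_lift`. -/
local notation "HasUnitaryLift[" σ "]" A:max =>
  ∃ U : Lp ℂ 2 (volume : Measure (σ → ℝ)) ≃ₗᵢ[ℂ] Lp ℂ 2 (volume : Measure (σ → ℝ)),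
    LiftsTo A ((LinearIsometryEquiv.toContinuousLinearEquiv U :
        Lp ℂ 2 (volume : Measure (σ → ℝ)) ≃L[ℂ] Lp ℂ 2 (volume : Measure (σ → ℝ))) :
      Lp ℂ 2 (volume : Measure (σ → ℝ)) →L[ℂ] Lp ℂ 2 (volume : Measure (σ → ℝ)))

variable (P Q) {R S}

/-- **phase maps under the swap**: the symplectic action of `(g_W, g_V) ∈ G_∞(R,S,P,Q)` at a relabelled point is the
action of `(g_V, g_W) ∈ G_∞(P,Q,R,S)` relabelled (`ι𝕎_swap_apply` read from the other side). [folklore] -/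
theorem γ𝕎_swap_comp (g : Ginf P Q R S) (p q : DPIdx P Q R S → ℝ) :
    (γ𝕎[R, S, P, Q]) ((g.2, g.1) : Ginf R S P Q) (p ∘ swapIdx R S P Q, q ∘ swapIdx R S P Q) =
      ((((γ𝕎[P, Q, R, S]) g (p, q)).1 ∘ swapIdx R S P Q), (((γ𝕎[P, Q, R, S]) g (p, q)).2 ∘ swapIdx R S P Q)) := by
  have h := ι𝕎_swap_apply (P := R) (Q := S) (R := P) (S := Q) g (p, q)
  change _ = ((((ι𝕎 P Q R S g).1 (p, q)).1 ∘ swapIdx R S P Q), (((ι𝕎 P Q R S g).1 (p, q)).2 ∘ swapIdx R S P Q))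
  rw [h]
  dsimp only
  rw [comp_swapIdx_symm_comp, comp_swapIdx_symm_comp]

/-- **transport of Schwartz implementers along the swap**: if `A` implements `ι𝕎_{RSPQ}(g_W, g_V)` then
`swapS ∘ A ∘ swapS⁻¹` implements `ι𝕎_{PQRS}(g_V, g_W)`. [folklore] -/
theorem isImplementerS_swap_conj {g : Ginf P Q R S}
    {A : (SR (DPIdx R S P Q)) →L[ℂ] SR (DPIdx R S P Q)}
    (hA : IsImplementerS ((γ𝕎[R, S, P, Q]) ((g.2, g.1) : Ginf R S P Q)) A) :
    IsImplementerS ((γ𝕎[P, Q, R, S]) g)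
      (((swapS R S P Q : (SR (DPIdx R S P Q)) ≃L[ℂ] SR (DPIdx P Q R S)) :
          (SR (DPIdx R S P Q)) →L[ℂ] SR (DPIdx P Q R S)).comp
        (A.comp (((swapS R S P Q).symm : (SR (DPIdx P Q R S)) ≃L[ℂ] SR (DPIdx R S P Q)) :
          (SR (DPIdx P Q R S)) →L[ℂ] SR (DPIdx R S P Q)))) := by
  refine ⟨fun p q f => ?_, ?_⟩
  · simp only [ContinuousLinearMap.comp_apply, ContinuousLinearEquiv.coe_coe]
    rw [swapS_symm_rhoS, hA.1, γ𝕎_swap_comp]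
    dsimp only
    rw [swapS_rhoS]
  · obtain ⟨U, hU⟩ := hA.2
    refine ⟨((l2Swap R S P Q).symm.trans U).trans (l2Swap R S P Q), ?_⟩
    exact liftsTo_opTransport_swap hU _ fun x => by simp

/-- **conjugating by the swap does not change the vacuum coefficient** (the swap is unitary on `L²` and fixes the
Gaussian). [folklore] -/
theorem vacCoeffS_swap_conj (A : (SR (DPIdx R S P Q)) →L[ℂ] SR (DPIdx R S P Q)) :
    vacCoeffS ((((swapS R S P Q : (SR (DPIdx R S P Q)) ≃L[ℂ] SR (DPIdx P Q R S)) :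
          (SR (DPIdx R S P Q)) →L[ℂ] SR (DPIdx P Q R S)).comp
        (A.comp (((swapS R S P Q).symm : (SR (DPIdx P Q R S)) ≃L[ℂ] SR (DPIdx R S P Q)) :
          (SR (DPIdx P Q R S)) →L[ℂ] SR (DPIdx R S P Q))))) = vacCoeffS A := by
  have hvac : (vacL2 : L2R (DPIdx P Q R S)) = l2Swap R S P Q (vacL2 : L2R (DPIdx R S P Q)) := by
    rw [← toL2_hermitePi_zero, ← toL2_hermitePi_zero, ← toL2_swapS]
    exact congrArg _ schwartzTransport_hermitePi_zero.symm
  rw [vacCoeffS, vacCoeffS]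
  simp only [ContinuousLinearMap.comp_apply, ContinuousLinearEquiv.coe_coe]
  rw [schwartzTransport_symm_hermitePi_zero, toL2_swapS, hvac, LinearIsometryEquiv.inner_map_map]

variable (r₀ : R) (s₀ : S)

/-- **`hypOpW t` implements the `W`-side boost** `ι𝕎 (1, hypV r₀ s₀ t)`. [cite: Folland1989, (4.24), Prop. (4.39)] -/
theorem isImplementerS_hypOpW (t : ℝ) :
    IsImplementerS ((γ𝕎[P, Q, R, S]) (((1 : UForm P Q), (hypV r₀ s₀ t : UForm R S)) : Ginf P Q R S))
      (hypOpW P Q r₀ s₀ t) :=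
  isImplementerS_swap_conj P Q (g := (((1 : UForm P Q), (hypV r₀ s₀ t : UForm R S)) : Ginf P Q R S))
    (isImplementerS_hypOp P Q r₀ s₀ t)

/-- the vacuum coefficient of `hypOpW t` is that of `hypOp t` of the swapped pair … [folklore] -/
theorem vacCoeffS_hypOpW (t : ℝ) : vacCoeffS (hypOpW P Q r₀ s₀ t) = vacCoeffS (hypOp P Q r₀ s₀ t) :=
  vacCoeffS_swap_conj P Q (hypOp P Q r₀ s₀ t)

/-- … hence positive real … [folklore] -/
theorem vacCoeffS_hypOpW_eq_norm (t : ℝ) :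
    vacCoeffS (hypOpW P Q r₀ s₀ t) = ((‖vacCoeffS (hypOpW P Q r₀ s₀ t)‖ : ℝ) : ℂ) := by
  rw [vacCoeffS_hypOpW]
  exact vacCoeffS_hypOp_eq_norm P Q r₀ s₀ t

/-- … and nonzero. [folklore] -/
theorem vacCoeffS_hypOpW_ne_zero (t : ℝ) : vacCoeffS (hypOpW P Q r₀ s₀ t) ≠ 0 := by
  rw [vacCoeffS_hypOpW]
  exact vacCoeffS_hypOp_ne_zero P Q r₀ s₀ t

/-- so `hypOpW` is its own vacuum normalisation. [folklore] -/
theorem vnormS_hypOpW (t : ℝ) : vnormS (hypOpW P Q r₀ s₀ t) = hypOpW P Q r₀ s₀ t :=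
  vnormS_eq_self (vacCoeffS_hypOpW_eq_norm P Q r₀ s₀ t) (vacCoeffS_hypOpW_ne_zero P Q r₀ s₀ t)

/-- **The `W`-side hyperbolic vacuum pin.** The canonical section of `JunctionVacuumSection` on the boosts of the
SECOND factor, `(1, hypV r₀ s₀ t) ∈ U(P,Q) × U(R,S)`, IS the transported hyperbolic family `hypOpW` of
`JunctionSwapBargmann`: `vacSection ι𝕎 (1, hypV r₀ s₀ t) = hypOpW P Q r₀ s₀ t`.
[cite: Folland1989, (4.24), Prop. (4.39)] -/
theorem vacSection_junction_one_hypV_eq_hypOpW (t : ℝ) :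
    vacSection (γ𝕎[P, Q, R, S]) (((1 : UForm P Q), (hypV r₀ s₀ t : UForm R S)) : Ginf P Q R S) =
      hypOpW P Q r₀ s₀ t :=
  (eq_vacSection (γ := γ𝕎[P, Q, R, S]) (g := (((1 : UForm P Q), (hypV r₀ s₀ t : UForm R S)) : Ginf P Q R S))
    (isImplementerS_hypOpW P Q r₀ s₀ t) (vacCoeffS_hypOpW_eq_norm P Q r₀ s₀ t)
    (vacCoeffS_hypOpW_ne_zero P Q r₀ s₀ t)).symm

/-- pointwise form of `vacSection_junction_one_hypV_eq_hypOpW`. [cite: Folland1989, (4.24), Prop. (4.39)] -/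
theorem vacSection_junction_one_hypV_apply (t : ℝ) (f : SR (DPIdx P Q R S)) :
    vacSection (γ𝕎[P, Q, R, S]) (((1 : UForm P Q), (hypV r₀ s₀ t : UForm R S)) : Ginf P Q R S) f =
      hypOpW P Q r₀ s₀ t f := by
  rw [vacSection_junction_one_hypV_eq_hypOpW]

/-- **slope of the canonical section on the `W`-boosts, on all of `𝓢`** (real scalars):
`t⁻¹ (vacSection ι𝕎 (1, hypV t) f − f) → hypOpWGen f` as `t → 0`. [cite: Folland1989, (4.24), Prop. (4.39)] -/
theorem tendsto_vacSection_one_hypV_sub_div (f : SR (DPIdx P Q R S)) :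
    Tendsto (fun t : ℝ => t⁻¹ •
      (vacSection (γ𝕎[P, Q, R, S]) (((1 : UForm P Q), (hypV r₀ s₀ t : UForm R S)) : Ginf P Q R S) f - f))
      (𝓝[≠] 0) (𝓝 (hypOpWGen P Q r₀ s₀ f)) := by
  simp only [vacSection_junction_one_hypV_apply]
  exact tendsto_hypOpW_sub_div P Q r₀ s₀ f

/-- the same slope with the complex scalar `(t : ℂ)⁻¹`. [cite: Folland1989, (4.24), Prop. (4.39)] -/
theorem tendsto_vacSection_one_hypV_sub_div_ofReal (f : SR (DPIdx P Q R S)) :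
    Tendsto (fun t : ℝ => ((t : ℝ) : ℂ)⁻¹ •
      (vacSection (γ𝕎[P, Q, R, S]) (((1 : UForm P Q), (hypV r₀ s₀ t : UForm R S)) : Ginf P Q R S) f - f))
      (𝓝[≠] 0) (𝓝 (hypOpWGen P Q r₀ s₀ f)) := by
  simp only [vacSection_junction_one_hypV_apply]
  exact tendsto_hypOpW_sub_div_ofReal P Q r₀ s₀ f

/-- **every real functional is smooth along the canonical section on the `W`-boosts**, with derivative through
`hypOpWGen`. [cite: Folland1989, (4.24), Prop. (4.39)] -/
theorem hasDerivAt_apply_vacSection_one_hypV {G : Type*} [NormedAddCommGroup G] [NormedSpace ℝ G]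
    (T : (SR (DPIdx P Q R S)) →L[ℝ] G) (f : SR (DPIdx P Q R S)) (s₀' : ℝ) :
    HasDerivAt (fun s : ℝ =>
        T (vacSection (γ𝕎[P, Q, R, S]) (((1 : UForm P Q), (hypV r₀ s₀ s : UForm R S)) : Ginf P Q R S) f))
      (T (hypOpWGen P Q r₀ s₀ (hypOpW P Q r₀ s₀ s₀' f))) s₀' := by
  simp only [vacSection_junction_one_hypV_apply]
  exact hasDerivAt_apply_hypOpW P Q r₀ s₀ T f s₀'

/-- `C^∞` version. [cite: Folland1989, (4.24), Prop. (4.39)] -/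
theorem contDiff_apply_vacSection_one_hypV {G : Type*} [NormedAddCommGroup G] [NormedSpace ℝ G]
    (T : (SR (DPIdx P Q R S)) →L[ℝ] G) (f : SR (DPIdx P Q R S)) :
    ContDiff ℝ ((⊤ : ℕ∞) : WithTop ℕ∞) fun s : ℝ =>
      T (vacSection (γ𝕎[P, Q, R, S]) (((1 : UForm P Q), (hypV r₀ s₀ s : UForm R S)) : Ginf P Q R S) f) := by
  simp only [vacSection_junction_one_hypV_apply]
  exact contDiff_apply_hypOpW P Q r₀ s₀ T f

open MvPolynomial in
/-- **the Fock slope of the canonical section on the `W`-boosts** — planes `(p, r₀) | (p, s₀)` (`λ = −π⁻¹`) and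
`(q, r₀) | (q, s₀)` (`λ = +π⁻¹`). [cite: Folland1989, §1.7, (4.24), Prop. (4.39)] -/
theorem tendsto_vacSection_one_hypV_binvPi_sub_div_frame (F : MvPolynomial (DPIdx P Q R S) ℂ) :
    Tendsto (fun t : ℝ => ((t : ℝ) : ℂ)⁻¹ •
      (vacSection (γ𝕎[P, Q, R, S]) (((1 : UForm P Q), (hypV r₀ s₀ t : UForm R S)) : Ginf P Q R S) (binvPi F) -
        binvPi F)) (𝓝[≠] 0)
      (𝓝 (binvPi (I • ((∑ q : Q, hypPairSymb (Sum.inr (Sum.inr (q, r₀))) (Sum.inl (Sum.inr (q, s₀))) F) -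
        ∑ p : P, hypPairSymb (Sum.inl (Sum.inl (p, r₀))) (Sum.inr (Sum.inl (p, s₀))) F)))) := by
  simp only [vacSection_junction_one_hypV_apply]
  exact tendsto_hypOpW_binvPi_sub_div_frame P Q r₀ s₀ F

variable {P Q r₀ s₀}

/-- **the `W`-side pin for a genuine Weil datum**: `ω ((1, hypV r₀ s₀ t)) = hypOpW P Q r₀ s₀ t` — the `V`-side pin
of the SWAPPED datum (`isArchWeilDatum_swap`) read back through `swapS`. [cite: Folland1989, §4.2 p. 156, Prop. (4.39)] -/
theorem weilDatum_apply_one_hypV_eq_hypOpW {ω : Representation ℂ (Ginf P Q R S) (SR (DPIdx P Q R S))}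
    (hW : IsArchWeilDatum (ι𝕎 P Q R S) ω) (r₀ : R) (s₀ : S) (t : ℝ) (f : SR (DPIdx P Q R S)) :
    ω (((1 : UForm P Q), (hypV r₀ s₀ t : UForm R S)) : Ginf P Q R S) f = hypOpW P Q r₀ s₀ t f := by
  have h := weilDatum_apply_hypV_eq_hypOp (R := P) (S := Q) (isArchWeilDatum_swap hW) r₀ s₀ t (swapS P Q R S f)
  have e1 : (schwartzTransport (swapCLE P Q R S)).symm (swapS P Q R S f) = f := (swapS P Q R S).symm_apply_apply f
  rw [repTransport_apply, MonoidHom.comp_apply, swapHom_apply, e1] at h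
  dsimp only at h
  have h2 : ω (((1 : UForm P Q), (hypV r₀ s₀ t : UForm R S)) : Ginf P Q R S) f =
      (swapS P Q R S).symm (hypOp P Q r₀ s₀ t (swapS P Q R S f)) := by
    rw [← h]
    exact ((swapS P Q R S).symm_apply_apply _).symm
  rw [h2, hypOpW_apply, swapS_symm_apply_eq, swapS_symm_apply_eq]

/-- … as an identity of linear maps. [cite: Folland1989, §4.2 p. 156, Prop. (4.39)] -/
theorem weilDatum_apply_one_hypV_eq {ω : Representation ℂ (Ginf P Q R S) (SR (DPIdx P Q R S))}
    (hW : IsArchWeilDatum (ι𝕎 P Q R S) ω) (r₀ : R) (s₀ : S) (t : ℝ) :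
    ω (((1 : UForm P Q), (hypV r₀ s₀ t : UForm R S)) : Ginf P Q R S) =
      ((hypOpW P Q r₀ s₀ t : (SR (DPIdx P Q R S)) →L[ℂ] SR (DPIdx P Q R S)) :
        (SR (DPIdx P Q R S)) →ₗ[ℂ] SR (DPIdx P Q R S)) :=
  LinearMap.ext fun f => by rw [ContinuousLinearMap.coe_coe]; exact weilDatum_apply_one_hypV_eq_hypOpW hW r₀ s₀ t f

/-- … and it coincides with the canonical section on the `W`-boosts. [cite: Folland1989, Prop. (4.39)] -/
theorem weilDatum_apply_one_hypV_eq_vacSection {ω : Representation ℂ (Ginf P Q R S) (SR (DPIdx P Q R S))}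
    (hW : IsArchWeilDatum (ι𝕎 P Q R S) ω) (r₀ : R) (s₀ : S) (t : ℝ) (f : SR (DPIdx P Q R S)) :
    ω (((1 : UForm P Q), (hypV r₀ s₀ t : UForm R S)) : Ginf P Q R S) f =
      vacSection (γ𝕎[P, Q, R, S]) (((1 : UForm P Q), (hypV r₀ s₀ t : UForm R S)) : Ginf P Q R S) f := by
  rw [weilDatum_apply_one_hypV_eq_hypOpW hW, vacSection_junction_one_hypV_apply]

/-- **slope of a Weil datum on the `W`-boosts, on all of `𝓢`**. [cite: Folland1989, (4.24), Prop. (4.39)] -/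
theorem weilDatum_tendsto_one_hypV_sub_div {ω : Representation ℂ (Ginf P Q R S) (SR (DPIdx P Q R S))}
    (hW : IsArchWeilDatum (ι𝕎 P Q R S) ω) (r₀ : R) (s₀ : S) (f : SR (DPIdx P Q R S)) :
    Tendsto (fun t : ℝ => t⁻¹ •
      (ω (((1 : UForm P Q), (hypV r₀ s₀ t : UForm R S)) : Ginf P Q R S) f - f))
      (𝓝[≠] 0) (𝓝 (hypOpWGen P Q r₀ s₀ f)) := by
  simp only [weilDatum_apply_one_hypV_eq_hypOpW hW]
  exact tendsto_hypOpW_sub_div P Q r₀ s₀ f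

/-- the same slope with the complex scalar `(t : ℂ)⁻¹`. [cite: Folland1989, (4.24), Prop. (4.39)] -/
theorem weilDatum_tendsto_one_hypV_sub_div_ofReal {ω : Representation ℂ (Ginf P Q R S) (SR (DPIdx P Q R S))}
    (hW : IsArchWeilDatum (ι𝕎 P Q R S) ω) (r₀ : R) (s₀ : S) (f : SR (DPIdx P Q R S)) :
    Tendsto (fun t : ℝ => ((t : ℝ) : ℂ)⁻¹ •
      (ω (((1 : UForm P Q), (hypV r₀ s₀ t : UForm R S)) : Ginf P Q R S) f - f))
      (𝓝[≠] 0) (𝓝 (hypOpWGen P Q r₀ s₀ f)) := by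
  simp only [weilDatum_apply_one_hypV_eq_hypOpW hW]
  exact tendsto_hypOpW_sub_div_ofReal P Q r₀ s₀ f

/-- **every real functional is smooth along a Weil datum on the `W`-boosts**. [cite: Folland1989, (4.24), Prop. (4.39)] -/
theorem weilDatum_hasDerivAt_apply_one_hypV {ω : Representation ℂ (Ginf P Q R S) (SR (DPIdx P Q R S))}
    (hW : IsArchWeilDatum (ι𝕎 P Q R S) ω) (r₀ : R) (s₀ : S) {G : Type*} [NormedAddCommGroup G]
    [NormedSpace ℝ G] (T : (SR (DPIdx P Q R S)) →L[ℝ] G) (f : SR (DPIdx P Q R S)) (s₀' : ℝ) :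
    HasDerivAt (fun s : ℝ => T (ω (((1 : UForm P Q), (hypV r₀ s₀ s : UForm R S)) : Ginf P Q R S) f))
      (T (hypOpWGen P Q r₀ s₀ (hypOpW P Q r₀ s₀ s₀' f))) s₀' := by
  simp only [weilDatum_apply_one_hypV_eq_hypOpW hW]
  exact hasDerivAt_apply_hypOpW P Q r₀ s₀ T f s₀'

/-- `C^∞` version. [cite: Folland1989, (4.24), Prop. (4.39)] -/
theorem weilDatum_contDiff_apply_one_hypV {ω : Representation ℂ (Ginf P Q R S) (SR (DPIdx P Q R S))}
    (hW : IsArchWeilDatum (ι𝕎 P Q R S) ω) (r₀ : R) (s₀ : S) {G : Type*} [NormedAddCommGroup G]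
    [NormedSpace ℝ G] (T : (SR (DPIdx P Q R S)) →L[ℝ] G) (f : SR (DPIdx P Q R S)) :
    ContDiff ℝ ((⊤ : ℕ∞) : WithTop ℕ∞) fun s : ℝ =>
      T (ω (((1 : UForm P Q), (hypV r₀ s₀ s : UForm R S)) : Ginf P Q R S) f) := by
  simp only [weilDatum_apply_one_hypV_eq_hypOpW hW]
  exact contDiff_apply_hypOpW P Q r₀ s₀ T f

open MvPolynomial in
/-- **the Fock slope of a Weil datum on the `W`-boosts**. [cite: Folland1989, §1.7, (4.24), Prop. (4.39)] -/
theorem weilDatum_tendsto_one_hypV_binvPi_sub_div_frame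
    {ω : Representation ℂ (Ginf P Q R S) (SR (DPIdx P Q R S))} (hW : IsArchWeilDatum (ι𝕎 P Q R S) ω)
    (r₀ : R) (s₀ : S) (F : MvPolynomial (DPIdx P Q R S) ℂ) :
    Tendsto (fun t : ℝ => ((t : ℝ) : ℂ)⁻¹ •
      (ω (((1 : UForm P Q), (hypV r₀ s₀ t : UForm R S)) : Ginf P Q R S) (binvPi F) - binvPi F)) (𝓝[≠] 0)
      (𝓝 (binvPi (I • ((∑ q : Q, hypPairSymb (Sum.inr (Sum.inr (q, r₀))) (Sum.inl (Sum.inr (q, s₀))) F) -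
        ∑ p : P, hypPairSymb (Sum.inl (Sum.inl (p, r₀))) (Sum.inr (Sum.inl (p, s₀))) F)))) := by
  simp only [weilDatum_apply_one_hypV_eq_hypOpW hW]
  exact tendsto_hypOpW_binvPi_sub_div_frame P Q r₀ s₀ F

end WSide

end RealDualPair

end Literature.RepresentationTheory.KonnoKonno2007

end
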